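import Summits.AtomisticToContinuum.HydrodynamicLimit.Theorems.ImplosionDichotomyPolynomialCompressionFrozenCommutator
import Summits.AtomisticToContinuum.HydrodynamicLimit.Theorems.ImplosionDichotomyPolynomialCompressionDifferenceSystem

/-!
# Level-1 forcing of the shadowing estimate: `P_V(∂ₗ δV) = ∂ₗ f − C_l(V; ∂δV)`

Helper file for the line `log-lipschitz-budget` of the crux `ImplosionDichotomy.PolynomialCompression`
(stmt-AtomisticToContinuum-12587), stub `stub_logBudgetShadowing`, blueprint §4 (level 1). Combines the
one-step commutator of a spatial derivative with the frozen-coefficient operator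
(`hsEuler_frozen_commutator_*`) with the difference system (`hsEuler_difference_*`: `P_V δV = f` for the
difference `δV` of the σ-solution `V` and a reference solution with law `ζ₂`): for every direction `l`,
the level-1 field `∂ₗ δV` solves the frozen system with right-hand side `∂ₗ f − C_l`, where `∂ₗ f` is the
spatial derivative of the EXPLICIT level-0 right-hand side (left unexpanded here, as a derivative of an
explicit function; expanded in `…Level1Expansion`) and `C_l` collects first derivatives of the coefficients
of `V` against first derivatives of `δV`.
-/

noncomputable section

namespace Summit.AtomisticToContinuum.HydrodynamicLimit.Theorems

open Set Filter Topology MeasureTheory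
open scoped ContDiff
open Literature.MathematicalPhysics.KineticTheory Literature.Analysis.FunctionSpaces

/-- **Level-1 forcing, density component.** [folklore] -/
theorem hsEuler_level1_forcing_density :
    ∀ {σ σ' T : ℝ} {ρ θ ρ' θ' : ℝ → T3 → ℝ} {u u' : ℝ → T3 → V3},
      IsHardSphereEulerSolution σ T ρ u θ → IsHardSphereEulerSolution σ' T ρ' u' θ' →
      ∀ {t : ℝ}, t ∈ Ico 0 T → ∀ (x : T3) (l : Fin 3),
        Torus.timeDerivWithin (Ico 0 T) (fun s => Torus.partialDeriv l (fun y => ρ s y - ρ' s y)) t x +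
            ∑ i, u t x i * Torus.partialDeriv i (Torus.partialDeriv l (fun y => ρ t y - ρ' t y)) x +
            ρ t x * ∑ i, Torus.partialDeriv i
              (fun y => Torus.partialDeriv l (fun z => u t z - u' t z) y i) x =
          Torus.partialDeriv l (fun y =>
              -((ρ t y - ρ' t y) * ∑ i, Torus.partialDeriv i (fun z => u' t z i) y) -
                ∑ i, (u t y i - u' t y i) * Torus.partialDeriv i (ρ' t) y) x -
            (∑ i, Torus.partialDeriv l (fun y => u t y i) x *
                Torus.partialDeriv i (fun y => ρ t y - ρ' t y) x +
              Torus.partialDeriv l (ρ t) x *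
                ∑ i, Torus.partialDeriv i (fun y => (u t y - u' t y) i) x) := by
  intro σ σ' T ρ θ ρ' θ' u u' hE hE' t ht x l
  have hα : Torus.IsSmoothSpaceTimeOn (Ico 0 T) (fun s y => ρ s y - ρ' s y) :=
    hE.smooth_density.sub hE'.smooth_density
  have hw : Torus.IsSmoothSpaceTimeOn (Ico 0 T) (fun s y => u s y - u' s y) :=
    hE.smooth_velocity.sub hE'.smooth_velocity
  have hJ := hsEuler_frozen_commutator_density (α := fun s y => ρ s y - ρ' s y)
    (w := fun s y => u s y - u' s y) hE hα hw ht x l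
  have hsub : ∀ i : Fin 3, (fun z : T3 => (u t z - u' t z) i) = fun z => u t z i - u' t z i :=
    fun i => funext fun z => by simp
  have hfun : (fun y => Torus.timeDerivWithin (Ico 0 T) (fun s y => ρ s y - ρ' s y) t y +
        ∑ i, u t y i * Torus.partialDeriv i (fun y => ρ t y - ρ' t y) y +
        ρ t y * ∑ i, Torus.partialDeriv i (fun z => (u t z - u' t z) i) y) =
      fun y => -((ρ t y - ρ' t y) * ∑ i, Torus.partialDeriv i (fun z => u' t z i) y) -
        ∑ i, (u t y i - u' t y i) * Torus.partialDeriv i (ρ' t) y := by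
    funext y
    have hG := hsEuler_difference_density hE hE' ht y
    simp only [hsub] at hG ⊢
    exact hG
  rw [hJ, hfun]

/-- **Level-1 forcing, velocity component** (laws `ζ` for `V`, `ζ₂` for the reference). [folklore] -/
theorem hsEuler_level1_forcing_velocity :
    ∀ {σ σ' T : ℝ} {ρ θ ρ' θ' : ℝ → T3 → ℝ} {u u' : ℝ → T3 → V3} {ζ ζ₂ : ℝ → ℝ} {J J₂ : Set ℝ},
      IsHardSphereEulerSolution σ T ρ u θ → IsHardSphereEulerSolution σ' T ρ' u' θ' → IsOpen J →
      ContDiffOn ℝ (⊤ : ℕ∞) ζ J → (∀ t ∈ Ico 0 T, ∀ x, ρ t x ∈ J) →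
      (∀ t ∈ Ico 0 T, ∀ x, hsPressure σ (ρ t x) (θ t x) = ρ t x * θ t x * ζ (ρ t x)) →
      IsOpen J₂ → ContDiffOn ℝ (⊤ : ℕ∞) ζ₂ J₂ → (∀ t ∈ Ico 0 T, ∀ x, ρ' t x ∈ J₂) →
      (∀ t ∈ Ico 0 T, ∀ x, hsPressure σ' (ρ' t x) (θ' t x) = ρ' t x * θ' t x * ζ₂ (ρ' t x)) →
      ∀ {t : ℝ}, t ∈ Ico 0 T → ∀ (x : T3) (l j : Fin 3),
        Torus.timeDerivWithin (Ico 0 T)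
              (fun s y => Torus.partialDeriv l (fun z => u s z - u' s z) y j) t x +
            ∑ i, u t x i * Torus.partialDeriv i
              (fun y => Torus.partialDeriv l (fun z => u t z - u' t z) y j) x +
            θ t x * (ζ (ρ t x) + ρ t x * deriv ζ (ρ t x)) / ρ t x *
              Torus.partialDeriv j (Torus.partialDeriv l (fun y => ρ t y - ρ' t y)) x +
            ζ (ρ t x) * Torus.partialDeriv j (Torus.partialDeriv l (fun y => θ t y - θ' t y)) x =
          Torus.partialDeriv l (fun y =>
              -(∑ i, (u t y i - u' t y i) * Torus.partialDeriv i (fun z => u' t z j) y) -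
                (θ t y * (ζ (ρ t y) + ρ t y * deriv ζ (ρ t y)) / ρ t y -
                    θ' t y * (ζ₂ (ρ' t y) + ρ' t y * deriv ζ₂ (ρ' t y)) / ρ' t y) *
                  Torus.partialDeriv j (ρ' t) y -
                (ζ (ρ t y) - ζ₂ (ρ' t y)) * Torus.partialDeriv j (θ' t) y) x -
            (∑ i, Torus.partialDeriv l (fun y => u t y i) x *
                Torus.partialDeriv i (fun y => (u t y - u' t y) j) x +
              Torus.partialDeriv l
                  (fun y => θ t y * (ζ (ρ t y) + ρ t y * deriv ζ (ρ t y)) / ρ t y) x *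
                Torus.partialDeriv j (fun y => ρ t y - ρ' t y) x +
              Torus.partialDeriv l (fun y => ζ (ρ t y)) x *
                Torus.partialDeriv j (fun y => θ t y - θ' t y) x) := by
  intro σ σ' T ρ θ ρ' θ' u u' ζ ζ₂ J J₂ hE hE' hJ hζ hρJ hp hJ₂ hζ₂ hρJ₂ hp' t ht x l j
  have hα : Torus.IsSmoothSpaceTimeOn (Ico 0 T) (fun s y => ρ s y - ρ' s y) :=
    hE.smooth_density.sub hE'.smooth_density
  have hw : Torus.IsSmoothSpaceTimeOn (Ico 0 T) (fun s y => u s y - u' s y) :=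
    hE.smooth_velocity.sub hE'.smooth_velocity
  have hβ : Torus.IsSmoothSpaceTimeOn (Ico 0 T) (fun s y => θ s y - θ' s y) :=
    hE.smooth_temperature.sub hE'.smooth_temperature
  have hJc := hsEuler_frozen_commutator_velocity (α := fun s y => ρ s y - ρ' s y)
    (w := fun s y => u s y - u' s y) (β := fun s y => θ s y - θ' s y) hE hJ hζ hρJ hα hw hβ ht x l j
  have hsub : ∀ i : Fin 3, (fun z : T3 => (u t z - u' t z) i) = fun z => u t z i - u' t z i :=
    fun i => funext fun z => by simp
  have hsub' : ∀ i : Fin 3, (fun s (z : T3) => (u s z - u' s z) i) = fun s z => u s z i - u' s z i :=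
    fun i => funext fun s => funext fun z => by simp
  have hfun : (fun y => Torus.timeDerivWithin (Ico 0 T) (fun s z => (u s z - u' s z) j) t y +
        ∑ i, u t y i * Torus.partialDeriv i (fun z => (u t z - u' t z) j) y +
        θ t y * (ζ (ρ t y) + ρ t y * deriv ζ (ρ t y)) / ρ t y *
          Torus.partialDeriv j (fun y => ρ t y - ρ' t y) y +
        ζ (ρ t y) * Torus.partialDeriv j (fun y => θ t y - θ' t y) y) =
      fun y => -(∑ i, (u t y i - u' t y i) * Torus.partialDeriv i (fun z => u' t z j) y) -
        (θ t y * (ζ (ρ t y) + ρ t y * deriv ζ (ρ t y)) / ρ t y -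
            θ' t y * (ζ₂ (ρ' t y) + ρ' t y * deriv ζ₂ (ρ' t y)) / ρ' t y) *
          Torus.partialDeriv j (ρ' t) y -
        (ζ (ρ t y) - ζ₂ (ρ' t y)) * Torus.partialDeriv j (θ' t) y := by
    funext y
    have hG := hsEuler_difference_velocity hE hE' hJ hζ hρJ hp hJ₂ hζ₂ hρJ₂ hp' ht y j
    simp only [hsub, hsub'] at hG ⊢
    exact hG
  rw [hJc, hfun]

/-- **Level-1 forcing, temperature component.** [folklore] -/
theorem hsEuler_level1_forcing_temperature :
    ∀ {σ σ' T : ℝ} {ρ θ ρ' θ' : ℝ → T3 → ℝ} {u u' : ℝ → T3 → V3} {ζ ζ₂ : ℝ → ℝ} {J J₂ : Set ℝ},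
      IsHardSphereEulerSolution σ T ρ u θ → IsHardSphereEulerSolution σ' T ρ' u' θ' → IsOpen J →
      ContDiffOn ℝ (⊤ : ℕ∞) ζ J → (∀ t ∈ Ico 0 T, ∀ x, ρ t x ∈ J) →
      (∀ t ∈ Ico 0 T, ∀ x, hsPressure σ (ρ t x) (θ t x) = ρ t x * θ t x * ζ (ρ t x)) →
      IsOpen J₂ → ContDiffOn ℝ (⊤ : ℕ∞) ζ₂ J₂ → (∀ t ∈ Ico 0 T, ∀ x, ρ' t x ∈ J₂) →
      (∀ t ∈ Ico 0 T, ∀ x, hsPressure σ' (ρ' t x) (θ' t x) = ρ' t x * θ' t x * ζ₂ (ρ' t x)) →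
      ∀ {t : ℝ}, t ∈ Ico 0 T → ∀ (x : T3) (l : Fin 3),
        Torus.timeDerivWithin (Ico 0 T) (fun s => Torus.partialDeriv l (fun y => θ s y - θ' s y)) t x +
            ∑ i, u t x i * Torus.partialDeriv i (Torus.partialDeriv l (fun y => θ t y - θ' t y)) x +
            2 / 3 * (θ t x * ζ (ρ t x)) *
              ∑ i, Torus.partialDeriv i (fun y => Torus.partialDeriv l (fun z => u t z - u' t z) y i) x =
          Torus.partialDeriv l (fun y =>
              -(∑ i, (u t y i - u' t y i) * Torus.partialDeriv i (θ' t) y) -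
                2 / 3 * (θ t y * ζ (ρ t y) - θ' t y * ζ₂ (ρ' t y)) *
                  ∑ i, Torus.partialDeriv i (fun z => u' t z i) y) x -
            (∑ i, Torus.partialDeriv l (fun y => u t y i) x *
                Torus.partialDeriv i (fun y => θ t y - θ' t y) x +
              2 / 3 * Torus.partialDeriv l (fun y => θ t y * ζ (ρ t y)) x *
                ∑ i, Torus.partialDeriv i (fun y => (u t y - u' t y) i) x) := by
  intro σ σ' T ρ θ ρ' θ' u u' ζ ζ₂ J J₂ hE hE' hJ hζ hρJ hp hJ₂ hζ₂ hρJ₂ hp' t ht x l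
  have hw : Torus.IsSmoothSpaceTimeOn (Ico 0 T) (fun s y => u s y - u' s y) :=
    hE.smooth_velocity.sub hE'.smooth_velocity
  have hβ : Torus.IsSmoothSpaceTimeOn (Ico 0 T) (fun s y => θ s y - θ' s y) :=
    hE.smooth_temperature.sub hE'.smooth_temperature
  have hJc := hsEuler_frozen_commutator_temperature (w := fun s y => u s y - u' s y)
    (β := fun s y => θ s y - θ' s y) hE hζ hρJ hw hβ ht x l
  have hsub : ∀ i : Fin 3, (fun z : T3 => (u t z - u' t z) i) = fun z => u t z i - u' t z i :=
    fun i => funext fun z => by simp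
  have hfun : (fun y => Torus.timeDerivWithin (Ico 0 T) (fun s y => θ s y - θ' s y) t y +
        ∑ i, u t y i * Torus.partialDeriv i (fun y => θ t y - θ' t y) y +
        2 / 3 * (θ t y * ζ (ρ t y)) * ∑ i, Torus.partialDeriv i (fun z => (u t z - u' t z) i) y) =
      fun y => -(∑ i, (u t y i - u' t y i) * Torus.partialDeriv i (θ' t) y) -
        2 / 3 * (θ t y * ζ (ρ t y) - θ' t y * ζ₂ (ρ' t y)) *
          ∑ i, Torus.partialDeriv i (fun z => u' t z i) y := by
    funext y
    have hG := hsEuler_difference_temperature hE hE' hJ hζ hρJ hp hJ₂ hζ₂ hρJ₂ hp' ht y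
    simp only [hsub] at hG ⊢
    exact hG
  rw [hJc, hfun]

end Summit.AtomisticToContinuum.HydrodynamicLimit.Theorems

end
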